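import Summits.HodgeConjecture.HodgeConjecture.Theorems.R90S4TwistedTransferDefs        -- ★ `IsStablyConjGAt` (stable conjugacy in `G_v` = conjugacy in `G̃_v`)
import Summits.HodgeConjecture.HodgeConjecture.Theorems.R90S4SplitFormGL                -- ★ `splitFormGL` (`(cmDatum L 3 ↑(splitFormGL L)).Local v` IS `Gqs L v` reducibly)
import Summits.HodgeConjecture.HodgeConjecture.Theorems.F0P3cStCharTSEllCartanCompact     -- ★ `isCompact_centralizer_iff_not_mem_hyperbolicSet` (compact centraliser ⟺ not hyperbolic), brings ★ `hyperbolicSet`, `Gqs`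
import Literature.NumberTheory.Automorphic.StableCentralizerEquivCM                       -- ★ `UnitaryGroup.localStableCentralizerEquiv` (`Z(γ) ≃ₜ* Z(γ′)` under stable conjugacy, §4.3)
import Literature.NumberTheory.Rogawski1990.LocalTransfer                                 -- ★ `isRegularElt_of_isConj`
import HarnessLib

/-!
# R90-TF · S4 «Ch. 13.1–2», brick (B2-S)(S2-M), part 1 — STABLE CONJUGACY PRESERVES THE TYPE OF THE CARTAN: compactness of the centraliser, and
# membership in the hyperbolic set, are STABLE invariants of regular elements of `U(Φ₃)(L⁺_v)` (Rogawski 1990, §3.1 p. 19, §3.6 pp. 28–31; §4.3 pp. 43–44)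

Cell `hodgecm-mathlib`, crux H413 (`stmt-HodgeConjecture-24833`, lane `--supports … --as helper`), route of record `HCCMUnconditional` (no route verbs;
count-neutral).  Programme R90-TF, section S4 (dealer seat vacant → CHAIR K2-lead (g2)); seat K2E3-p12 (g10), take-by-default (`R90/STATUS.md` 2026-09-04T23:55Z) after the census
`K2/K2E3-p12/g10/CENSUS-SWIF-at-S4.K2E3-p12-g10.md` §3: first brick of the STABLE REGROUPING (B2-S) behind ★ p862981's `IsStableWeylMeasure` — the passage from the plain Weyl
measure (★ p863297 `IsPlainWeylMeasure`, indexed by CONJUGACY classes of Cartan subgroups) to the stable one (indexed by STABLE classes).  THEOREMS ONLY — no `def`, no instance,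
no notation, no `sorry`; ★-only imports.

## THE MATHEMATICS
Stably conjugate regular elements `γ ∼_{st} γ′` of `G_v = U(Φ)(L⁺_v)` (conjugate in `G̃_v = GL₃(L ⊗ L⁺_v)`, ★ `IsStablyConjGAt`) have centralisers that are ISOMORPHIC AS TOPOLOGICAL GROUPS,
by the conjugator-independent map `t ↦ x t x⁻¹` (★ `UnitaryGroup.localStableCentralizerEquiv`: the cocycle `x⁻¹ ε(x)` lies in the commutative `GL₃`-centraliser of the regular
`γ`, so conjugation by `x` commutes with `ε` on `Z(γ)` — Rogawski §3.1–3.2, «`T^δ = g⁻¹ T g` is well-defined up to conjugacy», §12.5 p. 183).  Hence (§1) COMPACTNESS of `Z(γ)` is a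
stable invariant, for every form `Φ` and every finite `v`; and (§2) at the quasi-split form of record and a non-split `v`, where ★ `isCompact_centralizer_iff_not_mem_hyperbolicSet` reads
«`Z(γ)` compact ⟺ `γ` is not conjugate into the split Cartan `M`», the HYPERBOLIC SET `Ω = Ad(G_v) M^{reg}` and its complement (the elliptic regular set `G^e`, p. 184) are UNIONS OF
STABLE CLASSES: a stable conjugate of a regular element of `M` is `G_v`-conjugate to SOME regular element of `M` (the Cartan `M^δ` is again of type (0), §3.6), and a stable conjugate
of an elliptic regular element is elliptic.  What this leaves of (S2-M) «on `M`, stable class = class» is the in-torus step «two regular elements of `M` with the same characteristic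
polynomial are `N(M)`-conjugate (equal or swapped by the Weyl reflection)» — part 2, not in this file.

## CONTENTS
* §1 (generic `Φ : GL₃(L)`, any finite `v`) `isCompact_centralizer_iff_of_isStablyConjGAt`.
* §2 (`Gqs L v`, `v` non-split) `mem_hyperbolicSet_iff_of_isStablyConjGAt`, `mem_hyperbolicSet_of_isStablyConjGAt`, `not_mem_hyperbolicSet_of_isStablyConjGAt`,
  `exists_isConj_cmTorus_of_isStablyConjGAt` (a stable conjugate of a regular element of `M` is conjugate to a regular element of `M`).

HONEST LABEL: HC_CM is proved only modulo the 7 printed citations (2 remaining named inputs: hLiu418 = stmt-HodgeConjecture-24832, h413 = stmt-HodgeConjecture-24833) until rung 0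
closes.  Structure lemma toward (B2-S); discharges no named input; (W-NP)∕(1D-CT) OPEN.  REL ≠ ★ ≠ BUILT.

## References
* [Rogawski1990] J. D. Rogawski, *Automorphic Representations of Unitary Groups in Three Variables*, Ann. of Math. Stud. 123 (1990), §3.1 p. 19, §3.2 pp. 19–20, §3.6 pp. 28–31,
  §4.3 pp. 43–44, §12.5 pp. 182–184.
-/

set_option autoImplicit false
set_option linter.dupNamespace false

noncomputable section

open NumberField IsDedekindDomain Topology
open scoped Matrix MatrixGroups
open Literature.NumberTheory.Automorphic Literature.NumberTheory.Automorphic.UnitaryGroup Literature.NumberTheory.Rogawski1990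
open Summit.HodgeConjecture.HodgeConjecture.Cruxes.H413

namespace Summit.HodgeConjecture.HodgeConjecture.R90.S4

/-! ## §1 Compactness of the centraliser is a stable invariant of regular elements (every form, every finite place) -/

section Generic

variable (L : Type) [Field L] [NumberField L] [IsCMField L] (Φ : GL (Fin 3) L) (v : HeightOneSpectrum (𝓞 ↥(maximalRealSubfield L)))

variable {L Φ v} in
/-- **`Z(γ)` compact ⟺ `Z(γ′)` compact for stably conjugate `γ, γ′ ∈ G_v` with `γ` regular** — the centralisers are isomorphic topological groups under `t ↦ x t x⁻¹`
for any `x ∈ G̃_v` with `x γ x⁻¹ = γ′` (★ `UnitaryGroup.localStableCentralizerEquiv`; `det Φ ≠ 0` since `Φ ∈ GL₃(L)`), and compactness of a subgroup is compactness of its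
subtype (`isCompact_iff_compactSpace`), invariant under homeomorphism.  Print: the stable class of `γ` is the union of the classes `γ^δ ∈ T^δ`, `δ ∈ 𝔇(T∕F)`, with `T^δ ≅ T`
over `F`. [cite: Rogawski1990, §3.1 p. 19; §4.3 pp. 43–44; §12.5 p. 183] -/
theorem isCompact_centralizer_iff_of_isStablyConjGAt {γ γ' : (cmDatum L 3 (Φ : Matrix (Fin 3) (Fin 3) L)).Local v}
    (hreg : IsRegularElt (γ.val : GL (Fin 3) (LocalRing L v))) (h : IsStablyConjGAt L Φ v γ γ') :
    IsCompact ((Subgroup.centralizer ({γ} : Set ((cmDatum L 3 (Φ : Matrix (Fin 3) (Fin 3) L)).Local v)) :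
        Set ((cmDatum L 3 (Φ : Matrix (Fin 3) (Fin 3) L)).Local v))) ↔
      IsCompact ((Subgroup.centralizer ({γ'} : Set ((cmDatum L 3 (Φ : Matrix (Fin 3) (Fin 3) L)).Local v)) :
        Set ((cmDatum L 3 (Φ : Matrix (Fin 3) (Fin 3) L)).Local v))) := by
  have hdet : ((Φ : GL (Fin 3) L) : Matrix (Fin 3) (Fin 3) L).det ≠ 0 := (Matrix.isUnits_det_units Φ).ne_zero
  let e := UnitaryGroup.localStableCentralizerEquiv L v hdet hdet h hreg
  rw [isCompact_iff_compactSpace, isCompact_iff_compactSpace]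
  exact ⟨fun _ => e.toHomeomorph.compactSpace, fun _ => e.symm.toHomeomorph.compactSpace⟩

end Generic

/-! ## §2 The hyperbolic set and the elliptic regular set are unions of stable classes (`U(Φ₃)(L⁺_v)`, `v` non-split) -/

section QuasiSplit

variable (L : Type) [Field L] [NumberField L] [IsCMField L] (v : HeightOneSpectrum (𝓞 ↥(maximalRealSubfield L)))

variable {L v} in
/-- **`γ ∈ Ω ⟺ γ′ ∈ Ω` for stably conjugate regular `γ, γ′ ∈ U(Φ₃)(L⁺_v)`** (`v` non-split), `Ω =` ★ `hyperbolicSet` = the conjugates of the regular elements of the split Cartan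
`M`: by ★ `isCompact_centralizer_iff_not_mem_hyperbolicSet` membership in `Ω` is «`Z(γ)` not compact», a stable invariant (§1); regularity of `γ′` is ★ `isRegularElt_of_isConj`.
[cite: Rogawski1990, §3.6 pp. 28–31; §12.5 pp. 182–184] -/
theorem mem_hyperbolicSet_iff_of_isStablyConjGAt (hns : ∀ w : PlacesOver L v, IsCMField.complexConj L • w.1 = w.1) {γ γ' : Gqs L v}
    (hreg : IsRegularElt (γ.val : GL (Fin 3) (LocalRing L v))) (h : IsStablyConjGAt L (splitFormGL L) v γ γ') :
    γ ∈ F0P3cStCharTSTorusDefs.hyperbolicSet L v ↔ γ' ∈ F0P3cStCharTSTorusDefs.hyperbolicSet L v := by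
  have hreg' : IsRegularElt (γ'.val : GL (Fin 3) (LocalRing L v)) := isRegularElt_of_isConj h hreg
  rw [← not_iff_not, ← F0P3cStCharTSEllCartanCompact.isCompact_centralizer_iff_not_mem_hyperbolicSet L v hns hreg,
    ← F0P3cStCharTSEllCartanCompact.isCompact_centralizer_iff_not_mem_hyperbolicSet L v hns hreg']
  exact isCompact_centralizer_iff_of_isStablyConjGAt (Φ := splitFormGL L) hreg h

variable {L v} in
/-- **A stable conjugate of a hyperbolic regular element is hyperbolic** (`v` non-split). [cite: Rogawski1990, §3.6 pp. 28–31; §12.5 p. 182] -/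
theorem mem_hyperbolicSet_of_isStablyConjGAt (hns : ∀ w : PlacesOver L v, IsCMField.complexConj L • w.1 = w.1) {γ γ' : Gqs L v}
    (hreg : IsRegularElt (γ.val : GL (Fin 3) (LocalRing L v))) (hγ : γ ∈ F0P3cStCharTSTorusDefs.hyperbolicSet L v)
    (h : IsStablyConjGAt L (splitFormGL L) v γ γ') : γ' ∈ F0P3cStCharTSTorusDefs.hyperbolicSet L v :=
  (mem_hyperbolicSet_iff_of_isStablyConjGAt hns hreg h).1 hγ

variable {L v} in
/-- **A stable conjugate of an elliptic regular element is elliptic** (`v` non-split): `γ ∉ Ω`, `γ ∼_{st} γ′` ⇒ `γ′ ∉ Ω` — the elliptic regular set `G^e` (p. 184: regular with compact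
centraliser, ★ `isCompact_centralizer_iff_not_mem_hyperbolicSet`) is a union of stable classes. [cite: Rogawski1990, §12.5 p. 184; §3.6 pp. 28–31] -/
theorem not_mem_hyperbolicSet_of_isStablyConjGAt (hns : ∀ w : PlacesOver L v, IsCMField.complexConj L • w.1 = w.1) {γ γ' : Gqs L v}
    (hreg : IsRegularElt (γ.val : GL (Fin 3) (LocalRing L v))) (hγ : γ ∉ F0P3cStCharTSTorusDefs.hyperbolicSet L v)
    (h : IsStablyConjGAt L (splitFormGL L) v γ γ') : γ' ∉ F0P3cStCharTSTorusDefs.hyperbolicSet L v :=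
  fun hγ' => hγ ((mem_hyperbolicSet_iff_of_isStablyConjGAt hns hreg h).2 hγ')

variable {L v} in
/-- **A stable conjugate of a regular element of the split Cartan `M` is `G_v`-CONJUGATE to a regular element of `M`** (`v` non-split): for `t ∈ M` regular and `γ′ ∼_{st} t`
there is a regular `t′ ∈ M` with `t′` conjugate to `γ′` IN `U(Φ₃)(L⁺_v)` — the Cartan subgroup `Z(γ′)` stably conjugate to `M` is conjugate to `M` (type (0) of §3.6 is alone in its
stable class of tori).  The remaining in-torus step of (S2-M) («`t′ ∈ {t, w₀ t w₀⁻¹}`») is part 2. [cite: Rogawski1990, §3.6 pp. 28–31; §12.5 p. 182] -/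
theorem exists_isConj_cmTorus_of_isStablyConjGAt (hns : ∀ w : PlacesOver L v, IsCMField.complexConj L • w.1 = w.1)
    {t : ↥(cmBorelTriple L 3 v).M} {γ' : Gqs L v}
    (hreg : IsRegularElt (((t : ↥(unitaryGroupOfForm (conjLocal L (IsCMField.complexConj L) v) (cmLocalForm L 3 v))) : Gqs L v).val :
      GL (Fin 3) (LocalRing L v)))
    (h : IsStablyConjGAt L (splitFormGL L) v ((t : ↥(unitaryGroupOfForm (conjLocal L (IsCMField.complexConj L) v) (cmLocalForm L 3 v))) : Gqs L v) γ') :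
    ∃ t' : ↥(cmBorelTriple L 3 v).M,
      IsRegularElt (((t' : ↥(unitaryGroupOfForm (conjLocal L (IsCMField.complexConj L) v) (cmLocalForm L 3 v))) : Gqs L v).val :
        GL (Fin 3) (LocalRing L v)) ∧
      IsConj ((t' : ↥(unitaryGroupOfForm (conjLocal L (IsCMField.complexConj L) v) (cmLocalForm L 3 v))) : Gqs L v) γ' :=
  mem_hyperbolicSet_of_isStablyConjGAt hns hreg ⟨t, hreg, IsConj.refl _⟩ h

end QuasiSplit

end Summit.HodgeConjecture.HodgeConjecture.R90.S4

end
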